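import Mathlib.LinearAlgebra.Matrix.ToLinearEquiv
import Literature.AlgebraicGeometry.Motives.WeilFormIsotropicExtension
import Literature.NumberTheory.QuadraticForms.MeyerProofs
import HarnessLib

/-!
# The Meyer step and signature bookkeeping for a Weil-type form (Serre IV §3.2; van Geemen 5.2)

Family `hodge`, layer `Literature/AlgebraicGeometry/Motives`; second lemma file (after
`Motives/WeilFormIsotropicExtension`, whose setting and notation are kept: `α² = -d < 0`,
`K = ℚ + ℚ α`, `E` an alternating `ℚ`-bilinear Weil-type form on a `K`-space `V`,
`S(x, y) = E(x, α y)` its symmetric form) behind the splitting of `E ⊕ E_{(m₁ r₁, -m₂ r₂)}` for a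
form of signature `(n, n)` (Hodge summit, `Theorems/HeckePrymWeilWeilTenfoldsSqrtMinus11` +
`StubAimingArithmetic`). Sources: J.-P. Serre, *A Course in Arithmetic*, Ch. IV §3.2, Cor. 2 to
Thm 8 ("A quadratic form of rank `≥ 5` represents `0` if and only if it is indefinite" — Meyer;
the tree's PROVED `Literature.NumberTheory.QuadraticForms.meyer_holds`); B. van Geemen, LNM 1594
(1994), Lemma 5.2 (2) (`H` "has signature `(n, n)`"), 5.4.

## What is here (everything PROVED; no definitions, no named facts)

* `weilForm_exists_isotropic_pair` — **the Meyer step**: for `ℚ`-subspaces `P`, `Q` of `V`,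
  `Q` `α`-stable, `S` positive definite on `P`, negative definite on `Q`, `E(P, Q) = 0`, both
  non-zero and `dim_ℚ (P + Q) ≥ 5`, there are `p ∈ P ∖ 0`, `q ∈ Q ∖ 0` with
  `S(p, p) + S(q, q) = 0`: the Gram matrix of `S` in a `ℚ`-basis of `P + Q`
  (`LinearMap.BilinForm.toMatrix'` of the pull-back to `ℚ^m`) is symmetric, non-singular
  (definite orthogonal pieces; `Matrix.exists_mulVec_eq_zero_iff`) and indefinite, so Meyer's
  theorem gives an isotropic vector `p + q ≠ 0`;
* `weilForm_neg_of_orthogonal` — signature bookkeeping: if `dim_K V = 2n`, `S` is positive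
  definite on `P` and negative definite on `N` (`K`-subspaces of dimension `n`), then `S` is
  negative definite on the `E`-orthogonal of `P` (a vector `v ⊥ P` with `S(v, v) ≥ 0` gives
  `(P + K v) ∩ N ∋ w ≠ 0` by dimension count, with `S(w, w) = S(p, p) + Nm(c) S(v, v) ≥ 0`);
* the `K`-orthogonal complement `ker E(y, ·) ⊓ ker E(α y, ·)` of a vector
  (`mem_ker_inf_ker_smul_iff`): `α`-stable (`weilForm_alpha_smul_mem_kPerp`), of `ℚ`-codimension
  `≤ 2` in any subspace (`finrank_le_finrank_inf_ker_add_one`,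
  `finrank_le_finrank_inf_kPerp_add_two`);
* the summed form `E ⊕ E_c` on `V × K²` (`bilinOrthSum` of `Motives/WeilDiscriminantProduct`,
  `diagWeilForm` of `Motives/WeilDiscriminantRealization` in the standard basis
  `Pi.basisFun K (Fin 2)`, weights `c`): `bilinOrthSum_diagWeilForm_mk/_swap/_smul_smul`
  (unfolding, alternating, Weil type) and its values on vectors with rational `K²`-component
  (`bilinOrthSum_diagWeilForm_ratVec`, `bilinOrthSum_diagWeilForm_ratVec_alpha`).

Not here: the induction assembling these into the splitting theorem (Hodge summit, loc. cit.),
Witt cancellation, discriminants.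

## References

* [Serre1973] J.-P. Serre, A Course in Arithmetic, GTM 7 (1973), Ch. IV §3.2, Thm 8 and Cor. 2.
* [vanGeemen1994HodgeAV] B. van Geemen, An introduction to the Hodge conjecture for abelian
  varieties, LNM 1594 (1994), Lemma 5.2, 5.4.
-/

noncomputable section

open Module
open Literature.NumberTheory.QuadraticForms

namespace Literature.AlgebraicGeometry.Motives

universe u v

variable {K : Type u} [Field K] [Algebra ℚ K] {α : K} {d : ℚ}

section Signature

variable {V : Type v} [AddCommGroup V] [Module ℚ V] [Module K V] [IsScalarTower ℚ K V]

/-! ### Meyer: an isotropic vector of `S` on `P ⊕ Q` -/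

/-- **The Meyer step.** For `ℚ`-subspaces `P`, `Q` of `V` with `Q` `α`-stable, `S` positive
definite on `P`, negative definite on `Q`, `E(P, Q) = 0`, both non-zero and `dim_ℚ (P + Q) ≥ 5`,
there are `p ∈ P ∖ 0`, `q ∈ Q ∖ 0` with `S(p, p) + S(q, q) = 0`: the Gram matrix of `S` on a
`ℚ`-basis of `P + Q` is symmetric, non-singular (definite orthogonal pieces) and indefinite, so by
Meyer's theorem (Serre, A Course in Arithmetic, Ch. IV §3.2 Cor. 2; the tree's PROVED
`meyer_holds`) `S` has an isotropic vector `p + q ≠ 0`. [folklore] -/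
theorem weilForm_exists_isotropic_pair [FiniteDimensional ℚ V] (hd : 0 < d)
    (hα : α * α = algebraMap ℚ K (-d)) (E : LinearMap.BilinForm ℚ V)
    (hE : ∀ x y : V, E x y = -E y x) (hW : ∀ x y : V, E (α • x) (α • y) = d * E x y)
    (P Q : Submodule ℚ V) (hQα : ∀ x ∈ Q, α • x ∈ Q)
    (hpos : ∀ x ∈ P, x ≠ 0 → 0 < E x (α • x)) (hneg : ∀ x ∈ Q, x ≠ 0 → E x (α • x) < 0)
    (hPQ : ∀ p ∈ P, ∀ q ∈ Q, E p q = 0) (hP : P ≠ ⊥) (hQ : Q ≠ ⊥)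
    (h5 : 5 ≤ finrank ℚ ↥(P ⊔ Q)) :
    ∃ p ∈ P, ∃ q ∈ Q, p ≠ 0 ∧ q ≠ 0 ∧ E p (α • p) + E q (α • q) = 0 := by
  have hc1 : ∀ p ∈ P, ∀ q ∈ Q, E p (α • q) = 0 := fun p hp q hq => hPQ p hp _ (hQα q hq)
  have hc2 : ∀ p ∈ P, ∀ q ∈ Q, E q (α • p) = 0 := fun p hp q hq => by
    rw [weilForm_apply_alpha_smul_symm E hd hα hE hW, hc1 p hp q hq]
  set U : Submodule ℚ V := P ⊔ Q
  let b := Module.finBasis ℚ U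
  let φ : (Fin (finrank ℚ U) → ℚ) →ₗ[ℚ] V :=
    U.subtype ∘ₗ (b.equivFun.symm : (Fin (finrank ℚ U) → ℚ) →ₗ[ℚ] U)
  let J : V →ₗ[ℚ] V := α • LinearMap.id
  let A : Matrix (Fin (finrank ℚ U)) (Fin (finrank ℚ U)) ℚ :=
    LinearMap.BilinForm.toMatrix' (E.compl₁₂ φ (J ∘ₗ φ))
  have hA : ∀ v w, Matrix.toBilin' A v w = E (φ v) (α • φ w) := fun v w => by
    simp only [A, Matrix.toBilin'_toMatrix', LinearMap.compl₁₂_apply, LinearMap.comp_apply, J,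
      LinearMap.smul_apply, LinearMap.id_apply]
  have hφU : ∀ v, φ v ∈ U := fun v => (b.equivFun.symm v).2
  have hφinj : ∀ v, φ v = 0 → v = 0 := fun v hv => by
    have h1 : b.equivFun.symm v = 0 := (Submodule.coe_eq_zero).1 hv
    exact b.equivFun.symm.map_eq_zero_iff.1 h1
  have hφsurj : ∀ u ∈ U, ∃ v, φ v = u := fun u hu => ⟨b.equivFun ⟨u, hu⟩, by simp [φ]⟩
  have hsymm : A.IsSymm := Matrix.IsSymm.ext fun i j => by
    simp only [A, LinearMap.BilinForm.toMatrix'_apply, LinearMap.compl₁₂_apply,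
      LinearMap.comp_apply, J, LinearMap.smul_apply, LinearMap.id_apply]
    exact weilForm_apply_alpha_smul_symm E hd hα hE hW _ _
  have hdet : A.det ≠ 0 := by
    intro h0
    obtain ⟨v, hv0, hv⟩ := Matrix.exists_mulVec_eq_zero_iff.2 h0
    refine hv0 (hφinj v ?_)
    obtain ⟨p, hp, q, hq, hpq⟩ := Submodule.mem_sup.1 (hφU v)
    have key : ∀ u ∈ U, E u (α • φ v) = 0 := fun u hu => by
      obtain ⟨w, rfl⟩ := hφsurj u hu
      rw [← hA, Matrix.toBilin'_apply', hv, dotProduct_zero]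
    have h1 := key p (Submodule.mem_sup_left hp)
    have h2 := key q (Submodule.mem_sup_right hq)
    rw [← hpq, smul_add, map_add, hc1 p hp q hq, add_zero] at h1
    rw [← hpq, smul_add, map_add, hc2 p hp q hq, zero_add] at h2
    have hp0 : p = 0 := by
      by_contra h
      exact (hpos p hp h).ne' h1
    have hq0 : q = 0 := by
      by_contra h
      exact (hneg q hq h).ne h2
    rw [← hpq, hp0, hq0, add_zero]
  obtain ⟨p₁, hp₁, hp₁0⟩ := (Submodule.ne_bot_iff P).1 hP
  obtain ⟨q₁, hq₁, hq₁0⟩ := (Submodule.ne_bot_iff Q).1 hQ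
  have hposA : ∃ v, 0 < Matrix.toBilin' A v v := by
    obtain ⟨v, hv⟩ := hφsurj p₁ (Submodule.mem_sup_left hp₁)
    exact ⟨v, by rw [hA, hv]; exact hpos p₁ hp₁ hp₁0⟩
  have hnegA : ∃ w, Matrix.toBilin' A w w < 0 := by
    obtain ⟨v, hv⟩ := hφsurj q₁ (Submodule.mem_sup_right hq₁)
    exact ⟨v, by rw [hA, hv]; exact hneg q₁ hq₁ hq₁0⟩
  obtain ⟨v, hv0, hv⟩ := meyer_holds A h5 hsymm hdet hposA hnegA
  rw [hA] at hv
  obtain ⟨p, hp, q, hq, hpq⟩ := Submodule.mem_sup.1 (hφU v)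
  rw [← hpq, weilForm_apply_add_alpha_add E hd hα hE hW (hc1 p hp q hq)] at hv
  have hx0 : p + q ≠ 0 := fun h => hv0 (hφinj v (by rw [← hpq, h]))
  refine ⟨p, hp, q, hq, ?_, ?_, hv⟩
  · rintro rfl
    rw [zero_add] at hx0
    rw [smul_zero, map_zero, zero_add] at hv
    exact (hneg q hq hx0).ne hv
  · rintro rfl
    rw [add_zero] at hx0
    rw [smul_zero, map_zero, add_zero] at hv
    exact (hpos p hp hx0).ne' hv

/-! ### The orthogonal complement of `P` is negative definite -/

/-- **Signature bookkeeping.** If `dim_K V = 2n`, `S` is positive definite on `P` (`dim_K P = n`)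
and negative definite on `N` (`dim_K N = n`), then `S` is negative definite on the `E`-orthogonal
of `P`: for `v ⊥ P`, `v ≠ 0`, `S(v, v) ≥ 0` is impossible since `(P + K v) ∩ N ≠ 0` by dimension
count and `S(p + c v, p + c v) = S(p, p) + Nm(c) S(v, v) ≥ 0`. [folklore] -/
theorem weilForm_neg_of_orthogonal [Module.Finite K V] (hd : 0 < d)
    (hα : α * α = algebraMap ℚ K (-d))
    (hK : ∀ k : K, ∃ a b : ℚ, k = algebraMap ℚ K a + algebraMap ℚ K b * α)
    (E : LinearMap.BilinForm ℚ V) (hE : ∀ x y : V, E x y = -E y x)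
    (hW : ∀ x y : V, E (α • x) (α • y) = d * E x y) {n : ℕ} (hV : finrank K V = 2 * n)
    (P N : Submodule K V) (hP : finrank K P = n) (hN : finrank K N = n)
    (hpos : ∀ x ∈ P, x ≠ 0 → 0 < E x (α • x)) (hneg : ∀ x ∈ N, x ≠ 0 → E x (α • x) < 0)
    {v : V} (hv : ∀ p ∈ P, E p v = 0) (hv0 : v ≠ 0) : E v (α • v) < 0 := by
  by_contra hcon
  push Not at hcon
  have hcv : ∀ (c : K), ∀ p ∈ P, E p (c • v) = 0 := fun c p hp => by
    refine weilForm_apply_kSmul_right_eq_zero E hK (hv p hp) ?_ c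
    have h := apply_smul_left_of_weil E hd.ne' hα hW p v
    have h2 := hv (α • p) (P.smul_mem α hp)
    linarith
  have hinf : P ⊓ Submodule.span K {v} = ⊥ := by
    rw [eq_bot_iff]
    rintro x ⟨hxP, hxv⟩
    obtain ⟨c, rfl⟩ := Submodule.mem_span_singleton.1 hxv
    rw [Submodule.mem_bot]
    by_contra hx0
    have h1 := hpos _ hxP hx0
    have h2 : E (c • v) (α • c • v) = 0 := by
      rw [hE, hcv c (α • c • v) (P.smul_mem α hxP), neg_zero]
    exact h1.ne' h2
  have h1 : finrank K ↥(P ⊔ Submodule.span K {v}) = n + 1 := by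
    have h := Submodule.finrank_sup_add_finrank_inf_eq P (Submodule.span K {v})
    rwa [hinf, finrank_bot, add_zero, finrank_span_singleton hv0, hP] at h
  have h2 : (P ⊔ Submodule.span K {v}) ⊓ N ≠ ⊥ := by
    intro h
    have h3 := Submodule.finrank_sup_add_finrank_inf_eq (P ⊔ Submodule.span K {v}) N
    rw [h, finrank_bot, add_zero, h1, hN] at h3
    have h4 := Submodule.finrank_le ((P ⊔ Submodule.span K {v}) ⊔ N)
    rw [hV] at h4
    omega
  obtain ⟨w, hw, hw0⟩ := (Submodule.ne_bot_iff _).1 h2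
  obtain ⟨hw1, hwN⟩ := Submodule.mem_inf.1 hw
  obtain ⟨p, hp, t, ht, rfl⟩ := Submodule.mem_sup.1 hw1
  obtain ⟨c, rfl⟩ := Submodule.mem_span_singleton.1 ht
  have hlt := hneg _ hwN hw0
  have hexp : E (p + c • v) (α • (p + c • v)) = E p (α • p) + E (c • v) (α • c • v) := by
    have e1 : E p (α • c • v) = 0 := by
      rw [smul_smul]
      exact hcv _ p hp
    have e2 : E (c • v) (α • p) = 0 := by
      rw [hE, hcv c _ (P.smul_mem α hp), neg_zero]
    simp only [smul_add, map_add, LinearMap.add_apply, e1, e2, add_zero, zero_add]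
  have hp0 : 0 ≤ E p (α • p) := by
    rcases eq_or_ne p 0 with rfl | h
    · simp
    · exact (hpos p hp h).le
  have hcv0 : 0 ≤ E (c • v) (α • c • v) := by
    obtain ⟨a, b, rfl⟩ := hK c
    rw [weilForm_apply_kSmul_alpha_kSmul E hα hE hW]
    exact mul_nonneg (by positivity) hcon
  rw [hexp] at hlt
  linarith

/-! ### `K`-orthogonal complements of a vector inside a `ℚ`-subspace -/

omit [Algebra ℚ K] [IsScalarTower ℚ K V] in
/-- Membership in the `K`-orthogonal complement `ker E(y, ·) ⊓ ker E(α y, ·)` of `y`. [folklore] -/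
theorem mem_ker_inf_ker_smul_iff {E : LinearMap.BilinForm ℚ V} {y x : V} :
    x ∈ LinearMap.ker (E y) ⊓ LinearMap.ker (E (α • y)) ↔ E y x = 0 ∧ E (α • y) x = 0 :=
  Iff.rfl

/-- The `K`-orthogonal complement of a vector is `α`-stable. [folklore] -/
theorem weilForm_alpha_smul_mem_kPerp (hd : 0 < d) (hα : α * α = algebraMap ℚ K (-d))
    (E : LinearMap.BilinForm ℚ V) (hW : ∀ x y : V, E (α • x) (α • y) = d * E x y) {y x : V}
    (hx : x ∈ LinearMap.ker (E y) ⊓ LinearMap.ker (E (α • y))) :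
    α • x ∈ LinearMap.ker (E y) ⊓ LinearMap.ker (E (α • y)) := by
  rw [mem_ker_inf_ker_smul_iff] at hx ⊢
  refine ⟨?_, by rw [hW, hx.1, mul_zero]⟩
  have h := apply_smul_left_of_weil E hd.ne' hα hW y x
  linarith [hx.2]

omit [Module K V] [IsScalarTower ℚ K V] in
/-- A hyperplane cuts the dimension of a subspace by at most one. [folklore] -/
theorem finrank_le_finrank_inf_ker_add_one [FiniteDimensional ℚ V] (P : Submodule ℚ V)
    (f : V →ₗ[ℚ] ℚ) : finrank ℚ P ≤ finrank ℚ ↥(P ⊓ LinearMap.ker f) + 1 := by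
  have h1 := Submodule.finrank_sup_add_finrank_inf_eq P (LinearMap.ker f)
  have h2 := LinearMap.finrank_range_add_finrank_ker f
  have h3 : finrank ℚ ↥(LinearMap.range f) ≤ 1 :=
    (Submodule.finrank_le _).trans (finrank_self ℚ).le
  have h4 : finrank ℚ ↥(P ⊔ LinearMap.ker f) ≤ finrank ℚ V := Submodule.finrank_le _
  omega

omit [Algebra ℚ K] [IsScalarTower ℚ K V] in
/-- The `K`-orthogonal complement of a vector has `ℚ`-codimension at most `2` in any subspace.
[folklore] -/
theorem finrank_le_finrank_inf_kPerp_add_two [FiniteDimensional ℚ V] (P : Submodule ℚ V)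
    (E : LinearMap.BilinForm ℚ V) (α : K) (y : V) :
    finrank ℚ P ≤ finrank ℚ ↥(P ⊓ (LinearMap.ker (E y) ⊓ LinearMap.ker (E (α • y)))) + 2 := by
  have h1 := finrank_le_finrank_inf_ker_add_one P (E y)
  have h2 := finrank_le_finrank_inf_ker_add_one (P ⊓ LinearMap.ker (E y)) (E (α • y))
  rw [inf_assoc] at h2
  omega

end Signature

/-! ### The summed form `E ⊕ E_c` on `V × K²` -/

section Total

variable {V : Type u} [AddCommGroup V] [Module ℚ V] [Module K V] [IsScalarTower ℚ K V]
  (hd : 0 < d) (hα : α * α = algebraMap ℚ K (-d))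
  (hK : ∀ k : K, ∃ a b : ℚ, k = algebraMap ℚ K a + algebraMap ℚ K b * α)
  (E : LinearMap.BilinForm ℚ V) (c : Fin 2 → ℚ)

omit [Module K V] [IsScalarTower ℚ K V] in
/-- Unfolding `E ⊕ E_c` on pairs. [folklore] -/
theorem bilinOrthSum_diagWeilForm_mk (v v' : V) (f f' : Fin 2 → K) :
    bilinOrthSum E (diagWeilForm hd hα hK (Pi.basisFun K (Fin 2)) c) (v, f) (v', f') =
      E v v' + diagWeilForm hd hα hK (Pi.basisFun K (Fin 2)) c f f' :=
  rfl

omit [Module K V] [IsScalarTower ℚ K V] in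
/-- `E ⊕ E_c` is alternating. [folklore] -/
theorem bilinOrthSum_diagWeilForm_swap (hE : ∀ x y : V, E x y = -E y x) (x y : V × (Fin 2 → K)) :
    bilinOrthSum E (diagWeilForm hd hα hK (Pi.basisFun K (Fin 2)) c) x y =
      -bilinOrthSum E (diagWeilForm hd hα hK (Pi.basisFun K (Fin 2)) c) y x := by
  rw [bilinOrthSum_apply, bilinOrthSum_apply, hE x.1, diagWeilForm_swap _ _ _ _ _ y.2]
  ring

omit [IsScalarTower ℚ K V] in
/-- `E ⊕ E_c` is of Weil type. [folklore] -/
theorem bilinOrthSum_diagWeilForm_smul_smul (hW : ∀ x y : V, E (α • x) (α • y) = d * E x y)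
    (x y : V × (Fin 2 → K)) :
    bilinOrthSum E (diagWeilForm hd hα hK (Pi.basisFun K (Fin 2)) c) (α • x) (α • y) =
      d * bilinOrthSum E (diagWeilForm hd hα hK (Pi.basisFun K (Fin 2)) c) x y := by
  rw [bilinOrthSum_apply, bilinOrthSum_apply, Prod.smul_fst, Prod.smul_fst, Prod.smul_snd,
    Prod.smul_snd, hW, diagWeilForm_smul_smul]
  ring

omit [Module K V] [IsScalarTower ℚ K V] in
/-- `(E ⊕ E_c)((v, s), (v', s')) = E(v, v')` for rational `s, s'`. [folklore] -/
theorem bilinOrthSum_diagWeilForm_ratVec (v v' : V) (s s' : Fin 2 → ℚ) :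
    bilinOrthSum E (diagWeilForm hd hα hK (Pi.basisFun K (Fin 2)) c)
      (v, fun i => algebraMap ℚ K (s i)) (v', fun i => algebraMap ℚ K (s' i)) = E v v' := by
  rw [bilinOrthSum_diagWeilForm_mk, diagWeilForm_ratVec_ratVec, add_zero]

omit [IsScalarTower ℚ K V] in
/-- `(E ⊕ E_c)((v, s), α (v', s')) = S(v, v') + Σ cᵢ sᵢ s'ᵢ` for rational `s, s'`. [folklore] -/
theorem bilinOrthSum_diagWeilForm_ratVec_alpha (v v' : V) (s s' : Fin 2 → ℚ) :
    bilinOrthSum E (diagWeilForm hd hα hK (Pi.basisFun K (Fin 2)) c)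
      (v, fun i => algebraMap ℚ K (s i)) (α • (v', fun i => algebraMap ℚ K (s' i))) =
      E v (α • v') + ∑ i, c i * (s i * s' i) := by
  rw [Prod.smul_mk, bilinOrthSum_diagWeilForm_mk, diagWeilForm_ratVec_alpha_ratVec]

end Total

end Literature.AlgebraicGeometry.Motives

end
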